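import Mathlib
import Literature.Probability.Percolation.BlockResampling
import Literature.Probability.Percolation.BondPercolationBlockIndependence
import Summits.CriticalPhenomena.CardyFormulaZ2.Theorems.CardySelfRefinementGradientComparabilityStubExistsPivotalOfNondegenerate
import HarnessLib

/-!
# Conditional variance of the crossing event given a layer: decoupling of disjointly read events

Crux `stmt-CriticalPhenomena-10269`
(`Summit.CriticalPhenomena.CardyFormulaZ2.Theses.CardySelfRefinement.GradientComparability`),
line **Sketch**, helper file of the stub `stub_bulkPivotalSum_diverges` (D3-bulk).  Vocabulary
(`Aloc`, `window`, `nnSupport`) from `CardySelfRefinementDefs` / `…RussoDriftModel`.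

## Mathematics

Let `W` be the window, `L ⊆ W` a layer, and `t_ξ = P((ζ ∖ L) ∪ ξ ∈ Aloc)` the probability of the
section of `Aloc` at the layer configuration `ξ ⊆ L`.  The conditional variance of `Aloc` given
the layer is `V = Σ_{ξ ⊆ L} P(ω ∩ L = ξ) t_ξ(1 − t_ξ)`.

**Theorem (`condVariance_ge_of_disjoint_supports`, registered sub-goal).**  Let `O` ("open
skeleton") and `K` ("closed skeleton") be events read off finite edge sets `S_O`, `S_K` with
`S_O ∩ S_K ∩ L = ∅`, such that `O ⊆ Aloc` and `K ⊆ Alocᶜ` on lattice configurations.  Then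
`P(O) · P(K) ≤ V`.

*Proof.*  With the block `B' = (W ∪ S_O ∪ S_K) ∖ L`, `t_{ω∩L} = P(Aloc | ω off B')`
(`blockCondProb`; `Aloc` reads only the window), so `V = ∫ Y(1−Y) dP`, which by the tree's
conditional-variance identity `measureReal_mem_and_resample_notMem` is
`(P⊗P){ω ∈ Aloc, ω' ∉ Aloc}` for `ω' = resample B' (ω, ω̃)`.  This is at least
`(P⊗P){ω ∈ O, ω' ∈ K} = ∫ 𝟙_O(ω) P(K | ω off B') dP(ω)`; the first factor is `σ(S_O)`-measurable,
the second `σ(S_K ∖ B')`-measurable, and `S_O ∩ (S_K ∖ B') ⊆ S_O ∩ S_K ∩ L = ∅`, so the integral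
factorises (`integral_mul_eq_of_edgeSigma`) into `P(O) · P(K)` (`map_resample_prod`).
-/

noncomputable section

namespace Summit.CriticalPhenomena.CardyFormulaZ2.Theorems.CardySelfRefinement

open scoped Topology
open Filter Set MeasureTheory
open Literature.Probability.LatticeModels Literature.Probability.Percolation
open Literature.Probability.Percolation.QuadCrossing
open Summit.CriticalPhenomena.CardyFormulaZ2.Theses.CardySelfRefinement

/-- **Decoupling.**  If `O` and `K` are events read off finite edge sets `S_O`, `S_K` sharing no
edge of the layer `L`, with `O ⊆ Aloc` and `K ⊆ Alocᶜ` on lattice configurations, then the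
conditional variance of `Aloc` given the layer is at least `P(O) P(K)`. -/
theorem condVariance_ge_of_disjoint_supports (m : ℕ) (F : Fin m → Quad (Set.univ : Set ℂ))
    {η : ℝ} (hη : η ≠ 0) {W L SO SK : Finset (Sym2 (Site 2))}
    (hW : (↑W : Set (Sym2 (Site 2))) = window m F η)
    {O K : Set (BondConfig (Site 2))} (hOm : MeasurableSet O) (hKm : MeasurableSet K)
    (hOdet : DeterminedBy O (↑SO : Set (Sym2 (Site 2))))
    (hKdet : DeterminedBy K (↑SK : Set (Sym2 (Site 2))))
    (hdisj : ∀ e ∈ SO, e ∈ SK → e ∉ L)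
    (hOA : O ∩ nnSupport ⊆ Aloc m F η) (hKA : ∀ ω ∈ K, ω ∈ nnSupport → ω ∉ Aloc m F η) :
    (bondPercolation (zdGraph 2) half).real O * (bondPercolation (zdGraph 2) half).real K ≤
      ∑ ξ ∈ L.powerset, (bondPercolation (zdGraph 2) half).real {ω | obs ω L = ξ} *
        ((bondPercolation (zdGraph 2) half).real
            {ω' : BondConfig (Site 2) | ω' \ ↑L ∪ ↑ξ ∈ Aloc m F η} *
          (1 - (bondPercolation (zdGraph 2) half).real
            {ω' : BondConfig (Site 2) | ω' \ ↑L ∪ ↑ξ ∈ Aloc m F η})) := by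
  classical
  set μ := bondPercolation (zdGraph 2) half with hμ
  set B' : Finset (Sym2 (Site 2)) := (W ∪ SO ∪ SK) \ L with hB'
  set t : Finset (Sym2 (Site 2)) → ℝ := fun ξ =>
    μ.real {ω' : BondConfig (Site 2) | ω' \ ↑L ∪ ↑ξ ∈ Aloc m F η} with ht
  -- Step 1: `P(Aloc | ω off B') = t (ω ∩ L)`
  have hsec : ∀ ω ζ : BondConfig (Site 2),
      (ω \ ↑B' ∪ ↑(obs ζ B') ∈ Aloc m F η ↔ ζ \ ↑L ∪ ↑(obs ω L) ∈ Aloc m F η) := by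
    intro ω ζ
    apply mem_Aloc_iff_of_inter_window_eq
    rw [← hW]
    ext e
    simp only [coe_obs, Set.mem_inter_iff, Set.mem_union, Set.mem_sdiff, hB', Finset.coe_sdiff,
      Finset.coe_union, Finset.mem_coe]
    constructor
    · rintro ⟨h | ⟨hζ, _, heL⟩, heW⟩
      · have heL : e ∈ L := by
          by_contra heL
          exact h.2 ⟨Or.inl (Or.inl heW), heL⟩
        exact ⟨Or.inr ⟨h.1, heL⟩, heW⟩
      · exact ⟨Or.inl ⟨hζ, heL⟩, heW⟩
    · rintro ⟨⟨hζ, heL⟩ | ⟨hω, heL⟩, heW⟩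
      · exact ⟨Or.inr ⟨hζ, Or.inl (Or.inl heW), heL⟩, heW⟩
      · exact ⟨Or.inl ⟨hω, fun h => h.2 heL⟩, heW⟩
  have hY : ∀ ω, blockCondProb (zdGraph 2) half B' (Aloc m F η) ω = t (obs ω L) := by
    intro ω
    rw [blockCondProb_eq_real]
    simp only [ht]
    congr 1
    ext ζ
    exact hsec ω ζ
  -- Step 1b: the conditional variance as an integral
  have hRHS : ∑ ξ ∈ L.powerset, μ.real {ω | obs ω L = ξ} * (t ξ * (1 - t ξ)) =
      ∫ ω, blockCondProb (zdGraph 2) half B' (Aloc m F η) ω *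
        (1 - blockCondProb (zdGraph 2) half B' (Aloc m F η) ω) ∂μ := by
    rw [← integral_comp_obs_eq_sum (zdGraph 2) half L (fun ξ => t ξ * (1 - t ξ))]
    refine integral_congr_ae (ae_of_all _ fun ω => ?_)
    simp only [hY]
  -- Step 2: the conditional-variance identity
  have h2 := measureReal_mem_and_resample_notMem (zdGraph 2) half B' (measurableSet_Aloc m F hη)
  -- Step 3: the sub-event `{ω ∈ O, ω' ∈ K}` (up to null sets)
  have hN : μ nnSupportᶜ = 0 := by
    have h : bondPercolation (zdGraph 2) half {ω | ¬ ω ⊆ (zdGraph 2).edgeSet} = 0 :=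
      ae_iff.1 ProbabilityTheory.setBernoulli_ae_subset
    simpa [nnSupport, Set.compl_setOf] using h
  have h3 : (μ.prod μ).real {x | x.1 ∈ O ∧ resample ↑B' x ∈ K} ≤
      (μ.prod μ).real {x | x.1 ∈ Aloc m F η ∧ resample ↑B' x ∉ Aloc m F η} := by
    have hsub : {x : BondConfig (Site 2) × BondConfig (Site 2) | x.1 ∈ O ∧ resample ↑B' x ∈ K} ⊆
        {x | x.1 ∈ Aloc m F η ∧ resample ↑B' x ∉ Aloc m F η} ∪
          (nnSupportᶜ ×ˢ Set.univ ∪ resample ↑B' ⁻¹' nnSupportᶜ) := by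
      rintro ⟨ω, ω'⟩ ⟨hO, hK⟩
      by_cases h1 : ω ∈ nnSupport
      · by_cases h1' : resample ↑B' (ω, ω') ∈ nnSupport
        · exact Or.inl ⟨hOA ⟨hO, h1⟩, hKA _ hK h1'⟩
        · exact Or.inr (Or.inr h1')
      · exact Or.inr (Or.inl ⟨h1, Set.mem_univ _⟩)
    have hnull1 : (μ.prod μ) (nnSupportᶜ ×ˢ (Set.univ : Set (BondConfig (Site 2)))) = 0 := by
      rw [Measure.prod_prod, hN, zero_mul]
    have hnull2 : (μ.prod μ) (resample ↑B' ⁻¹' nnSupportᶜ) = 0 := by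
      rw [← Measure.map_apply (measurable_resample _) measurableSet_nnSupport.compl,
        map_resample_prod, hN]
    calc (μ.prod μ).real {x | x.1 ∈ O ∧ resample ↑B' x ∈ K}
        ≤ (μ.prod μ).real ({x | x.1 ∈ Aloc m F η ∧ resample ↑B' x ∉ Aloc m F η} ∪
            (nnSupportᶜ ×ˢ Set.univ ∪ resample ↑B' ⁻¹' nnSupportᶜ)) := measureReal_mono hsub
      _ ≤ (μ.prod μ).real {x | x.1 ∈ Aloc m F η ∧ resample ↑B' x ∉ Aloc m F η} +
            (μ.prod μ).real (nnSupportᶜ ×ˢ Set.univ ∪ resample ↑B' ⁻¹' nnSupportᶜ) :=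
          measureReal_union_le _ _
      _ = (μ.prod μ).real {x | x.1 ∈ Aloc m F η ∧ resample ↑B' x ∉ Aloc m F η} := by
          have h0 : (μ.prod μ).real
              (nnSupportᶜ ×ˢ (Set.univ : Set (BondConfig (Site 2))) ∪
                resample ↑B' ⁻¹' nnSupportᶜ) = 0 := by
            rw [measureReal_def, measure_union_null hnull1 hnull2, ENNReal.toReal_zero]
          rw [h0, add_zero]
  -- Step 4: Fubini for the sub-event
  set k : BondConfig (Site 2) → ℝ := fun ω => μ.real {ω' | resample ↑B' (ω, ω') ∈ K} with hk
  have hs4 : MeasurableSet {x : BondConfig (Site 2) × BondConfig (Site 2) |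
      x.1 ∈ O ∧ resample ↑B' x ∈ K} := (measurable_fst hOm).inter (measurable_resample _ hKm)
  have h4 : (μ.prod μ).real {x | x.1 ∈ O ∧ resample ↑B' x ∈ K} =
      ∫ ω, O.indicator (1 : BondConfig (Site 2) → ℝ) ω * k ω ∂μ := by
    rw [measureReal_prod_eq_integral (zdGraph 2) half hs4]
    refine integral_congr_ae (ae_of_all _ fun ω => ?_)
    by_cases hω : ω ∈ O
    · have hset : Prod.mk ω ⁻¹' {x : BondConfig (Site 2) × BondConfig (Site 2) |
          x.1 ∈ O ∧ resample ↑B' x ∈ K} = {ω' | resample ↑B' (ω, ω') ∈ K} := by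
        ext ω'
        exact ⟨fun h => h.2, fun h => ⟨hω, h⟩⟩
      show μ.real _ = O.indicator (1 : BondConfig (Site 2) → ℝ) ω * k ω
      rw [hset, Set.indicator_of_mem hω, Pi.one_apply, one_mul]
    · have hset : Prod.mk ω ⁻¹' {x : BondConfig (Site 2) × BondConfig (Site 2) |
          x.1 ∈ O ∧ resample ↑B' x ∈ K} = ∅ := by
        ext ω'
        exact ⟨fun h => absurd h.1 hω, fun h => h.elim⟩
      show μ.real _ = O.indicator (1 : BondConfig (Site 2) → ℝ) ω * k ω
      rw [hset, measureReal_empty, Set.indicator_of_notMem hω, zero_mul]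
  -- Step 5: independence of the two factors
  have hk_eq : ∀ ω, k ω = ∑ ξ ∈ B'.powerset, μ.real {ζ | obs ζ B' = ξ} *
      K.indicator 1 (ω \ ↑B' ∪ ↑ξ) := fun ω =>
    measureReal_setOf_resample_mem_section (zdGraph 2) half B' hKm ω
  have hk_bcp : k = blockCondProb (zdGraph 2) half B' K := funext hk_eq
  have hk_meas : Measurable k := hk_bcp ▸ measurable_blockCondProb (zdGraph 2) half B' hKm
  have hKdet' := (determinedBy_iff _ _).1 hKdet
  have hk_det : ∀ ω, k ω = k (ω ∩ (↑SK \ ↑B')) := by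
    intro ω
    rw [hk_eq, hk_eq]
    refine Finset.sum_congr rfl fun ξ _ => ?_
    have hiff := hKdet' (ω \ ↑B' ∪ ↑ξ) ((ω ∩ (↑SK \ ↑B')) \ ↑B' ∪ ↑ξ) (by
      ext e
      simp only [Set.mem_inter_iff, Set.mem_union, Set.mem_sdiff, Finset.mem_coe]
      tauto)
    by_cases hmem : ω \ ↑B' ∪ ↑ξ ∈ K
    · rw [Set.indicator_of_mem hmem, Set.indicator_of_mem (hiff.1 hmem), Pi.one_apply, Pi.one_apply]
    · rw [Set.indicator_of_notMem hmem, Set.indicator_of_notMem fun h => hmem (hiff.2 h)]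
  have hk_edge : Measurable[edgeSigma (↑SK \ ↑B')] k :=
    measurable_edgeSigma_of_forall_inter hk_meas _ hk_det
  have hO_edge : Measurable[edgeSigma (↑SO : Set (Sym2 (Site 2)))]
      (O.indicator (1 : BondConfig (Site 2) → ℝ)) :=
    measurable_indicator_one_edgeSigma hOdet hOm
  have hdisjST : Disjoint (↑SO : Set (Sym2 (Site 2))) (↑SK \ ↑B') := by
    rw [Set.disjoint_left]
    rintro e heO ⟨heK, heB'⟩
    apply heB'
    rw [Finset.mem_coe] at heO heK
    rw [Finset.mem_coe, hB', Finset.mem_sdiff, Finset.mem_union, Finset.mem_union]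
    exact ⟨Or.inl (Or.inr heO), hdisj e heO heK⟩
  have h5 : ∫ ω, O.indicator (1 : BondConfig (Site 2) → ℝ) ω * k ω ∂μ =
      (∫ ω, O.indicator (1 : BondConfig (Site 2) → ℝ) ω ∂μ) * ∫ ω, k ω ∂μ :=
    integral_mul_eq_of_edgeSigma (zdGraph 2) half hdisjST hO_edge hk_edge
  -- Step 6: the two marginals
  have h6a : ∫ ω, O.indicator (1 : BondConfig (Site 2) → ℝ) ω ∂μ = μ.real O :=
    integral_indicator_one hOm
  have h6b : ∫ ω, k ω ∂μ = μ.real K := by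
    have hsK : MeasurableSet {x : BondConfig (Site 2) × BondConfig (Site 2) |
        resample ↑B' x ∈ K} := measurable_resample _ hKm
    have h := measureReal_prod_eq_integral (zdGraph 2) half hsK
    rw [measureReal_setOf_resample_mem (zdGraph 2) half B' hKm] at h
    exact h.symm
  -- combine
  calc μ.real O * μ.real K
      = ∫ ω, O.indicator (1 : BondConfig (Site 2) → ℝ) ω * k ω ∂μ := by rw [h5, h6a, h6b]
    _ = (μ.prod μ).real {x | x.1 ∈ O ∧ resample ↑B' x ∈ K} := h4.symm
    _ ≤ (μ.prod μ).real {x | x.1 ∈ Aloc m F η ∧ resample ↑B' x ∉ Aloc m F η} := h3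
    _ = _ := h2
    _ = _ := hRHS.symm

end Summit.CriticalPhenomena.CardyFormulaZ2.Theorems.CardySelfRefinement

end
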